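import Mathlib
import Summits.NavierStokesRegularity.NavierStokesRegularity.Theorems.LevelSetModerationHighSpeedPressureWorkIsoLevelGain
import Summits.NavierStokesRegularity.NavierStokesRegularity.Theorems.LevelSetModerationHighSpeedPressureWorkSliceDecay
import Summits.NavierStokesRegularity.NavierStokesRegularity.Theorems.LevelSetModerationHighSpeedPressureWorkCostCauchySchwarz

/-!
# Route LevelSetModeration — crux 2 `HighSpeedPressureWork`: the LINEAR dyadic level recursion

Support lemma for item stmt-NavierStokesRegularity-18149 (`HighSpeedPressureWork`), step (i) of the
round-2 crux idea `iso-speed-area-closure` (`LinearLevelRecursion`): for every member of the data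
class and every level `c > 0`,

  `V_{2c}(T) ≤ C · E₀^{1/3} · c^{-5/3} · 𝒟¹_c(T)`,

where `V_{2c}(T) = ∫₀ᵀ |{|u(τ)| > 2c}| dτ` is the occupation above `2c` and
`𝒟¹_c(T) = ∫₀ᵀ ∫ 1_{|u|>c} ‖∇|u|‖` the total AREA of the iso-speed surfaces above `c` (coarea), with
ONE absolute constant `C`. Per slice: the isoperimetric gain `|{|v|>2c}| ≤ (4/c)^{3/2} C₁ (∫1_{|v|>c}‖∇|v|‖)^{3/2}`
(`sliceVolumeGain_one`, the super-level set being bounded by `levelSetModeration_isBounded_superlevel`)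
and energy Chebyshev `|{|v|>2c}| ≤ E₀/(4c²)` (`levelSetModeration_volume_superlevel_le`) combine as
`V = V^{1/3}·V^{2/3} ≤ (E₀/(4c²))^{1/3} · (4/c) C₁^{2/3} · ∫1_{|v|>c}‖∇|v|‖`; then integrate in time.
Consequently ANY area law `ν 𝒟¹_c ≤ Λ₁ (2c)^{m₁} V_c` turns into `V_{2c} ≤ θ(c) V_c` with
`θ(c) ∝ E₀^{1/3} Λ₁ ν⁻¹ c^{m₁ − 5/3} → 0` iff `m₁ < 5/3` (the `L¹` image of De Giorgi's `10/3`).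
-/

noncomputable section

-- single-conjunct summit: `Summit.<Summit>.<Problem>` repeats the name by the D-0017 layout
set_option linter.dupNamespace false

namespace Summit.NavierStokesRegularity.NavierStokesRegularity.Theorems

open MeasureTheory Set Filter Topology Function
open scoped ENNReal NNReal
open Literature.Analysis.FluidPDE

/-- **Two bounds combine through `V = V^{1/3} V^{2/3}`** (extended reals): if `V ≤ A` and
`V ≤ B · I^{3/2}` then `V ≤ A^{1/3} · B^{2/3} · I`. [folklore] -/
theorem ennreal_le_rpow_third_mul_of_le_of_le_mul_rpow {V A B I : ℝ≥0∞} (hA : V ≤ A) (hAtop : A ≠ ∞)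
    (hB : V ≤ B * I ^ (3 / 2 : ℝ)) :
    V ≤ A ^ (1 / 3 : ℝ) * B ^ (2 / 3 : ℝ) * I := by
  rcases eq_or_ne V 0 with hV0 | hV0
  · rw [hV0]; exact bot_le
  have hVtop : V ≠ ∞ := ne_top_of_le_ne_top hAtop hA
  have hsplit : V = V ^ (1 / 3 : ℝ) * V ^ (2 / 3 : ℝ) := by
    rw [← ENNReal.rpow_add _ _ hV0 hVtop]; norm_num
  have h1 : V ^ (1 / 3 : ℝ) ≤ A ^ (1 / 3 : ℝ) := ENNReal.rpow_le_rpow hA (by norm_num)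
  have h2 : V ^ (2 / 3 : ℝ) ≤ B ^ (2 / 3 : ℝ) * I := by
    calc V ^ (2 / 3 : ℝ) ≤ (B * I ^ (3 / 2 : ℝ)) ^ (2 / 3 : ℝ) := ENNReal.rpow_le_rpow hB (by norm_num)
      _ = B ^ (2 / 3 : ℝ) * I := by
          rw [ENNReal.mul_rpow_of_nonneg _ _ (by norm_num), ← ENNReal.rpow_mul]
          norm_num
  calc V = V ^ (1 / 3 : ℝ) * V ^ (2 / 3 : ℝ) := hsplit
    _ ≤ A ^ (1 / 3 : ℝ) * (B ^ (2 / 3 : ℝ) * I) := mul_le_mul' h1 h2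
    _ = A ^ (1 / 3 : ℝ) * B ^ (2 / 3 : ℝ) * I := by rw [mul_assoc]

/-- **The linear dyadic level recursion (per slice).** With the absolute constant
`C₁ = lintegralPowLePowLIntegralFDerivConst volume (3/2)`: for a `C¹` field `v` on `ℝ³` with
`∫ ‖v‖² ≤ E₀`-type Chebyshev bound `|{|v| > 2c}| ≤ ofReal (E₀/(4c²))` and `{|v| > c}` bounded,
`|{|v| > 2c}| ≤ ofReal ((E₀/(4c²))^{1/3} (4/c)) · C₁^{2/3} · ∫ 1_{|v|>c} ‖∇|v|‖`. [folklore] -/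
theorem sliceVolume_twoLevel_linear
    (v : EuclideanSpace ℝ (Fin 3) → EuclideanSpace ℝ (Fin 3)) {c E₀ : ℝ} (hv : ContDiff ℝ 1 v)
    (hc : 0 < c) (hE₀ : 0 ≤ E₀) (hbdd : Bornology.IsBounded {x | c < ‖v x‖})
    (hcheb : volume {x | 2 * c < ‖v x‖} ≤ ENNReal.ofReal (E₀ / (4 * c ^ 2))) :
    volume {x | 2 * c < ‖v x‖} ≤
      ENNReal.ofReal ((E₀ / (4 * c ^ 2)) ^ (1 / 3 : ℝ) * (4 / c)) *
        (lintegralPowLePowLIntegralFDerivConst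
            (volume : Measure (EuclideanSpace ℝ (Fin 3))) (3 / 2 : ℝ) : ℝ≥0∞) ^ (2 / 3 : ℝ) *
        ∫⁻ x, {x | c < ‖v x‖}.indicator (fun x => ‖fderiv ℝ (fun y => ‖v y‖) x‖ₑ) x := by
  set C₁ : ℝ≥0 := lintegralPowLePowLIntegralFDerivConst
    (volume : Measure (EuclideanSpace ℝ (Fin 3))) (3 / 2 : ℝ) with hC₁
  set I : ℝ≥0∞ := ∫⁻ x, {x | c < ‖v x‖}.indicator (fun x => ‖fderiv ℝ (fun y => ‖v y‖) x‖ₑ) x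
    with hI
  have hgain := sliceVolumeGain_one v c (2 * c) hv hc (by linarith) hbdd
  have h2c : 2 * c - c = c := by ring
  rw [h2c] at hgain
  -- `V ≤ A^{1/3} B^{2/3} I` with `A = ofReal (E₀/(4c²))`, `B = ofReal ((4/c)^{3/2}) C₁`
  have hcomb := ennreal_le_rpow_third_mul_of_le_of_le_mul_rpow hcheb ENNReal.ofReal_ne_top hgain
  refine hcomb.trans (le_of_eq ?_)
  have h4c : 0 ≤ 4 / c := by positivity
  rw [ENNReal.mul_rpow_of_nonneg _ _ (by norm_num : (0 : ℝ) ≤ 2 / 3),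
    ENNReal.ofReal_rpow_of_nonneg (by positivity) (by norm_num : (0 : ℝ) ≤ 1 / 3),
    ENNReal.ofReal_rpow_of_nonneg (by positivity) (by norm_num : (0 : ℝ) ≤ 2 / 3),
    ← Real.rpow_mul h4c, show (3 / 2 : ℝ) * (2 / 3) = 1 by norm_num, Real.rpow_one,
    ENNReal.ofReal_mul (by positivity)]
  simp only [hC₁, hI, mul_assoc]

/-- **LINEAR DYADIC LEVEL RECURSION for the data class** (step (i) of idea `iso-speed-area-closure`).
There is an absolute constant `C > 0` such that for every classical solution on `ℝ³ × [0,T)` that is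
Leray–Hopf from a rapidly decaying datum with `∫|u₀|² ≤ E₀`, and every level `c > 0`:
`∫₀ᵀ |{|u(τ)| > 2c}| dτ ≤ C E₀^{1/3} c^{-5/3} · ∫₀ᵀ ∫ 1_{|u|>c} ‖∇|u|‖` (occupation above `2c` against
the iso-speed surface AREA above `c`; `sliceVolume_twoLevel_linear` integrated in time). [folklore] -/
theorem levelSetModeration_linearLevelRecursion :
    ∃ C : ℝ, 0 < C ∧ ∀ (ν T : ℝ) (u : ℝ → EuclideanSpace ℝ (Fin 3) → EuclideanSpace ℝ (Fin 3)) (p : ℝ → EuclideanSpace ℝ (Fin 3) → ℝ), 0 < ν → 0 < T → Literature.Analysis.FluidPDE.IsClassicalNSSolutionOn (Set.Ico 0 T) ν 0 u p → Literature.Analysis.FluidPDE.IsLerayHopfOn T ν 0 (u 0) u → Literature.Analysis.FluidPDE.HasRapidSpatialDecay (u 0) → ∀ (E₀ c : ℝ), (∫ x, ‖u 0 x‖ ^ 2) ≤ E₀ → 0 < c → (∫⁻ τ in Set.Ioo 0 T, MeasureTheory.volume {x | 2 * c < ‖u τ x‖}) ≤ ENNReal.ofReal (C * E₀ ^ ((1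 : ℝ) / 3) * c ^ (-(5 : ℝ) / 3)) * ∫⁻ τ in Set.Ioo 0 T, ∫⁻ x, Set.indicator {x | c < ‖u τ x‖} (fun x => ENNReal.ofReal ‖fderiv ℝ (fun y => ‖u τ y‖) x‖) x := by
  set C₁ : ℝ≥0 := lintegralPowLePowLIntegralFDerivConst
    (volume : Measure (EuclideanSpace ℝ (Fin 3))) (3 / 2 : ℝ) with hC₁
  -- the absolute constant: `4^{2/3} C₁^{2/3} + 1`
  refine ⟨(4 : ℝ) ^ (2 / 3 : ℝ) * (C₁ : ℝ) ^ (2 / 3 : ℝ) + 1, by positivity, ?_⟩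
  intro ν T u p hν hT hcl hLH hdec E₀ c hE₀ hc
  have hE₀0 : 0 ≤ E₀ := le_trans (integral_nonneg fun _ => sq_nonneg _) hE₀
  -- per-slice bound
  set K : ℝ≥0∞ := ENNReal.ofReal ((E₀ / (4 * c ^ 2)) ^ (1 / 3 : ℝ) * (4 / c)) *
    (C₁ : ℝ≥0∞) ^ (2 / 3 : ℝ) with hK
  have hKtop : K ≠ ∞ :=
    ENNReal.mul_ne_top ENNReal.ofReal_ne_top (ENNReal.rpow_ne_top_of_nonneg (by norm_num)
      ENNReal.coe_ne_top)
  have hslice : ∀ τ ∈ Ioo 0 T, volume {x | 2 * c < ‖u τ x‖} ≤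
      K * ∫⁻ x, {x | c < ‖u τ x‖}.indicator
        (fun x => ENNReal.ofReal ‖fderiv ℝ (fun y => ‖u τ y‖) x‖) x := by
    intro τ hτ
    have hτ' : τ ∈ Ico 0 T := ⟨hτ.1.le, hτ.2⟩
    have hv : ContDiff ℝ 1 (u τ) := (hcl.contDiff_velocity hτ').of_le (by norm_cast)
    have hbdd : Bornology.IsBounded {x | c < ‖u τ x‖} :=
      levelSetModeration_isBounded_superlevel ν T u p hν hcl hLH hdec τ hτ' c hc
    -- Chebyshev at level `2c`
    have hcheb : volume {x | 2 * c < ‖u τ x‖} ≤ ENNReal.ofReal (E₀ / (4 * c ^ 2)) := by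
      have h1 := levelSetModeration_volume_superlevel_le hν.le hLH (Ioo_subset_Icc_self hτ)
        (by positivity : 0 < 2 * c)
      refine h1.trans ?_
      have hKE : 2 * VectorCalculus.kineticEnergy (u 0) ≤ E₀ := by
        rw [VectorCalculus.kineticEnergy]
        have : 2 * (2⁻¹ * ∫ x, ‖u 0 x‖ ^ 2) = ∫ x, ‖u 0 x‖ ^ 2 := by ring
        rw [this]; exact hE₀
      have hpos : 0 < (2 * c) ^ 2 := by positivity
      rw [← ENNReal.ofReal_div_of_pos hpos]
      refine ENNReal.ofReal_le_ofReal ?_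
      rw [show (2 * c) ^ 2 = 4 * c ^ 2 by ring]
      exact div_le_div_of_nonneg_right hKE (by positivity)
    have h := sliceVolume_twoLevel_linear (u τ) hv hc hE₀0 hbdd hcheb
    refine h.trans (le_of_eq ?_)
    rw [hK]
    congr 1
    refine lintegral_congr fun x => ?_
    by_cases hx : x ∈ {x | c < ‖u τ x‖}
    · rw [indicator_of_mem hx, indicator_of_mem hx, ofReal_norm]
    · rw [indicator_of_notMem hx, indicator_of_notMem hx]
  -- integrate in time
  have hint : (∫⁻ τ in Ioo 0 T, volume {x | 2 * c < ‖u τ x‖}) ≤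
      K * ∫⁻ τ in Ioo 0 T, ∫⁻ x, {x | c < ‖u τ x‖}.indicator
        (fun x => ENNReal.ofReal ‖fderiv ℝ (fun y => ‖u τ y‖) x‖) x := by
    rw [← lintegral_const_mul' _ _ hKtop]
    exact setLIntegral_mono' measurableSet_Ioo fun τ hτ => hslice τ hτ
  refine hint.trans (mul_le_mul' ?_ le_rfl)
  -- `K ≤ ofReal (C E₀^{1/3} c^{-5/3})`
  rw [hK]
  have hC₁0 : 0 ≤ (C₁ : ℝ) := C₁.coe_nonneg
  have hcoe : (C₁ : ℝ≥0∞) ^ (2 / 3 : ℝ) = ENNReal.ofReal ((C₁ : ℝ) ^ (2 / 3 : ℝ)) := by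
    rw [← NNReal.coe_rpow, ENNReal.ofReal_coe_nnreal, ENNReal.coe_rpow_of_nonneg _ (by norm_num)]
  rw [hcoe, ← ENNReal.ofReal_mul (by positivity)]
  refine ENNReal.ofReal_le_ofReal ?_
  -- real algebra: `(E₀/(4c²))^{1/3} (4/c) C₁^{2/3} ≤ (4^{2/3} C₁^{2/3} + 1) E₀^{1/3} c^{-5/3}`
  have hc13 : (E₀ / (4 * c ^ 2)) ^ (1 / 3 : ℝ) * (4 / c) =
      (4 : ℝ) ^ (2 / 3 : ℝ) * (E₀ ^ (1 / 3 : ℝ) * c ^ (-(5 : ℝ) / 3)) := by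
    rw [Real.div_rpow hE₀0 (by positivity), Real.mul_rpow (by norm_num) (by positivity),
      ← Real.rpow_natCast c 2, ← Real.rpow_mul hc.le]
    have h4 : (4 : ℝ) / (4 : ℝ) ^ (1 / 3 : ℝ) = (4 : ℝ) ^ (2 / 3 : ℝ) := by
      rw [div_eq_iff (by positivity), ← Real.rpow_add (by norm_num)]
      norm_num
    have hcpow : c ^ (-(5 : ℝ) / 3) = (c ^ ((2 : ℕ) * (1 / 3 : ℝ)))⁻¹ * c⁻¹ := by
      rw [← Real.rpow_neg_one c, ← Real.rpow_neg hc.le, ← Real.rpow_add hc]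
      norm_num
    rw [hcpow]
    field_simp
    rw [← h4]
    field_simp
  rw [hc13]
  have hX : 0 ≤ E₀ ^ (1 / 3 : ℝ) * c ^ (-(5 : ℝ) / 3) := by positivity
  have h13 : (1 : ℝ) / 3 = 1 / 3 := rfl
  calc (4 : ℝ) ^ (2 / 3 : ℝ) * (E₀ ^ (1 / 3 : ℝ) * c ^ (-(5 : ℝ) / 3)) * (C₁ : ℝ) ^ (2 / 3 : ℝ)
      = ((4 : ℝ) ^ (2 / 3 : ℝ) * (C₁ : ℝ) ^ (2 / 3 : ℝ)) * (E₀ ^ (1 / 3 : ℝ) * c ^ (-(5 : ℝ) / 3)) := by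
        ring
    _ ≤ ((4 : ℝ) ^ (2 / 3 : ℝ) * (C₁ : ℝ) ^ (2 / 3 : ℝ) + 1) * (E₀ ^ (1 / 3 : ℝ) * c ^ (-(5 : ℝ) / 3)) := by
        gcongr; linarith
    _ = ((4 : ℝ) ^ (2 / 3 : ℝ) * (C₁ : ℝ) ^ (2 / 3 : ℝ) + 1) * E₀ ^ ((1 : ℝ) / 3) * c ^ (-(5 : ℝ) / 3) := by
        ring

end Summit.NavierStokesRegularity.NavierStokesRegularity.Theorems

end
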